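import Literature.NumberTheory.LFunctions.Voros2006OesterleProofs
import Literature.NumberTheory.LFunctions.EquivalentsKeiperLiProofs
import Summits.RiemannHypothesis.RiemannHypothesis.Theorems.Splittings.LiIndexSets
import Summits.RiemannHypothesis.RiemannHypothesis.Theorems.Splittings.LiIndexSetsSyndetic
import Literature.NumberTheory.LFunctions.RiemannHypothesisUpTo1000X
import Summits.RiemannHypothesis.RiemannHypothesis.Statement
import HarnessLib

/-!
# Splittings — Li bridge lens, the EXTREMAL-LAYER LAW for `λ_n`, part 1/3: positive-weight trigonometric sums take BOTH signs, with a
# margin, in EVERY window of bounded length (pure harmonic analysis, no zeta; SPLIT-li-bridge gen 5 §§1–2; DEF-CARRYING part)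

Cell rh-split, seat rh-split-li-bridge g5 (brief sha16 f79c5f09d8bcb036), card `run/shared/lean/pub/rh-split/cards/SPLIT-li-bridge.md`
§12 (gen-5 addendum; lead rh-split-lead g2 ROUTED 2026-08-27T04:37:55Z «carve plan §12.7 A/B … zero-def (12 bookkeeping defs → spell out
or cite); bytes to referee g3 first»); source `HOME/rh-split-li-bridge/SketchG5.lean` sha16 11e7614000dc855f (856 l, ns `RhSplit.LiBridgeG5`).
Filed by rh-split-typer-1 g4 in three parts (400-line rule): `LiExtremalLayerWindow` (§§1–2), `LiExtremalLayer` (§§3–4 + the syndetic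
corollaries), `LiSignPatterns` (§§5–6).  Tree inputs (cited, not re-derived): `Voros2006_eqDA_holds`, `Voros2006_thm_onlyif_holds`,
`li_criterion_holds`, `riemannHypothesis_iff_liPosOn_thick` + `IsThick` / `HasGapsLe` / `RecurrentFor` (Theorems/Splittings/LiIndexSets*),
`liZeroBox_finite`, `FordL33.order_pos/coe_ne_zero`, `LiIndexSets.one_lt_norm_inv_one_sub_inv_iff`, `LiIndexSets.re_eq_half_of_abs_im_le`,
`riemannHypothesisUpTo_1000`.
This part carries the seven finite-sum ABBREVIATIONS of the scratch's §2 as definitions (data-valued bookkeeping, no `Prop`; card §12.7: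
«the seven §2 abbreviations are finite-sum bookkeeping — def lane or spelled out» — def lane chosen, as for `LiGeometricQuadruple`):
`trigSum E m u n = Σ_{i∈E} m_i Re(u_iⁿ)`, `mass = Σ m_i`, `sqMass = Σ m_i²`, `meanConst = Σ m_i·2/‖1 − u_i‖`,
`varConst = Σ_{i,j} m_i m_j (1/‖1 − u_i u_j‖ + 1/‖1 − u_i ū_j‖)`, `windowLen = ⌈4(C₂ + M C₁)/σ²⌉₊ + 1`, `margin = σ²/(8M)`.
HONEST LABEL: «SPLITTING SEARCH over kernel-typed RH-EQUIVALENCES; a splitting A ∧ B ⟹ RH is CONDITIONAL bookkeeping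
unless A and B are both proved; nothing here bears on the truth of RH.»  Every theorem below is RH-FREE (an implication /
dichotomy proved outright) or an RH-EQUIVALENCE.

* §1 window sums of powers of a point of the closed unit disc (`norm_sum_Ico_pow_le`, `neg_le_re_sum_Ico_pow` — including the resonant
  case `v = 1`, where Lean's `2/0 = 0` is the right floor —, `abs_re_sum_Ico_pow_le`);
* §2 **window theorem** (`window_two_signs`): a positive-weight trigonometric sum `h(n) = Σ_{i∈E} m_i Re(u_iⁿ)`, `m_i > 0`, `‖u_i‖ = 1`,
  `u_i ≠ 1`, takes a value `≥ η` AND a value `≤ −η` in EVERY window `[N, N+L₀)` — `η = σ²/(8M)`, `L₀ = ⌈4(C₂ + M C₁)/σ²⌉ + 1` explicit.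
  Mechanism: window mean `O(1)` (geometric sums, `u_i ≠ 1`; `abs_sum_trigSum_le`), window mean-square `≥ Lσ²/2 − O(1)` (positive weights make
  every resonance `u_i u_j = 1`, `u_i = u_j` contribute `≥ 0`; `sum_trigSum_sq_ge`), `|h| ≤ M` (`abs_trigSum_le`).  No Kronecker/Dirichlet, no
  rational-independence hypothesis.
Parts 2–3: `LiExtremalLayer` (layer law, two-signed exponential oscillation of `λ_n` with bounded gaps under `¬RH`, the `∅ / syndetic`
dichotomy), `LiSignPatterns` (increments, thick / density-one monotonicity and positivity criteria — the card's T-Li2 and V6 in kernel —, runs).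
-/

set_option linter.dupNamespace false

noncomputable section

open Complex Filter Topology Finset Asymptotics
open scoped Real ComplexConjugate

namespace Summit.RiemannHypothesis.RiemannHypothesis.Theorems.Splittings.LiExtremalLayer

open Literature.NumberTheory.LFunctions
open Summit.RiemannHypothesis.RiemannHypothesis.Theorems.Splittings
open Summit.RiemannHypothesis.RiemannHypothesis.Theorems.Splittings.LiIndexSets

/-! ## §1 Window sums of powers of a point of the closed unit disc -/

/-- `‖Σ_{n ∈ [N, N+L)} vⁿ‖ ≤ 2/‖1 − v‖` for `‖v‖ ≤ 1`, `v ≠ 1`. -/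
theorem norm_sum_Ico_pow_le {v : ℂ} (hv : ‖v‖ ≤ 1) (hv1 : v ≠ 1) (N L : ℕ) :
    ‖∑ n ∈ Ico N (N + L), v ^ n‖ ≤ 2 / ‖1 - v‖ := by
  rw [geom_sum_Ico hv1 (Nat.le_add_right N L), norm_div]
  have h1 : ‖v - 1‖ = ‖1 - v‖ := by rw [← norm_neg, neg_sub]
  rw [h1]
  have hpos : 0 < ‖1 - v‖ := norm_pos_iff.2 (sub_ne_zero.2 (Ne.symm hv1))
  refine div_le_div_of_nonneg_right ?_ hpos.le
  calc ‖v ^ (N + L) - v ^ N‖ ≤ ‖v ^ (N + L)‖ + ‖v ^ N‖ := norm_sub_le _ _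
    _ ≤ 1 + 1 := by
        rw [norm_pow, norm_pow]
        exact add_le_add (pow_le_one₀ (norm_nonneg _) hv) (pow_le_one₀ (norm_nonneg _) hv)
    _ = 2 := by norm_num

/-- Uniform real-part floor `Re Σ_{n ∈ [N, N+L)} vⁿ ≥ −2/‖1 − v‖`, INCLUDING the resonant case `v = 1`
(where the window sum is `L ≥ 0` and `2/‖1 − v‖ = 2/0 = 0`). -/
theorem neg_le_re_sum_Ico_pow {v : ℂ} (hv : ‖v‖ ≤ 1) (N L : ℕ) :
    -(2 / ‖1 - v‖) ≤ (∑ n ∈ Ico N (N + L), v ^ n).re := by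
  by_cases hv1 : v = 1
  · subst hv1
    simp
  · have h := (abs_re_le_norm (∑ n ∈ Ico N (N + L), v ^ n)).trans (norm_sum_Ico_pow_le hv hv1 N L)
    exact (abs_le.1 h).1

/-- `|Re Σ_{n ∈ [N, N+L)} vⁿ| ≤ 2/‖1 − v‖` for `v ≠ 1`. -/
theorem abs_re_sum_Ico_pow_le {v : ℂ} (hv : ‖v‖ ≤ 1) (hv1 : v ≠ 1) (N L : ℕ) :
    |(∑ n ∈ Ico N (N + L), v ^ n).re| ≤ 2 / ‖1 - v‖ :=
  (abs_re_le_norm _).trans (norm_sum_Ico_pow_le hv hv1 N L)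

/-! ## §2 Positive-weight trigonometric sums `h(n) = Σ_i m_i Re(u_iⁿ)` on the unit circle:
both signs, with a margin, in EVERY window of bounded length -/

variable {ι : Type*}

/-- `h(n) = Σ_{i ∈ E} m_i · Re(u_iⁿ)`. -/
def trigSum (E : Finset ι) (m : ι → ℝ) (u : ι → ℂ) (n : ℕ) : ℝ := ∑ i ∈ E, m i * (u i ^ n).re

/-- Total mass `M = Σ m_i`. -/
def mass (E : Finset ι) (m : ι → ℝ) : ℝ := ∑ i ∈ E, m i

/-- Square mass `σ² = Σ m_i²`. -/
def sqMass (E : Finset ι) (m : ι → ℝ) : ℝ := ∑ i ∈ E, m i ^ 2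

/-- Window constant for the mean: `C₁ = Σ_i m_i · 2/‖1 − u_i‖`. -/
def meanConst (E : Finset ι) (m : ι → ℝ) (u : ι → ℂ) : ℝ := ∑ i ∈ E, m i * (2 / ‖1 - u i‖)

/-- Window constant for the mean square: `C₂ = Σ_{i,j} m_i m_j (1/‖1 − u_i u_j‖ + 1/‖1 − u_i ū_j‖)`
(resonant pairs contribute `1/0 = 0`). -/
def varConst (E : Finset ι) (m : ι → ℝ) (u : ι → ℂ) : ℝ :=
  ∑ i ∈ E, ∑ j ∈ E, m i * m j * (1 / ‖1 - u i * u j‖ + 1 / ‖1 - u i * conj (u j)‖)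

section Window

variable {E : Finset ι} {m : ι → ℝ} {u : ι → ℂ}

/-- `|h(n)| ≤ M`. -/
theorem abs_trigSum_le (hm : ∀ i ∈ E, 0 ≤ m i) (hu : ∀ i ∈ E, ‖u i‖ = 1) (n : ℕ) :
    |trigSum E m u n| ≤ mass E m := by
  unfold trigSum mass
  refine (Finset.abs_sum_le_sum_abs _ _).trans (Finset.sum_le_sum fun i hi ↦ ?_)
  rw [abs_mul, abs_of_nonneg (hm i hi)]
  have : |(u i ^ n).re| ≤ 1 := by
    refine (abs_re_le_norm _).trans ?_
    rw [norm_pow, hu i hi, one_pow]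
  nlinarith [hm i hi]

/-- The window sums of `h` are bounded: `|Σ_{n ∈ [N,N+L)} h(n)| ≤ C₁`. -/
theorem abs_sum_trigSum_le (hm : ∀ i ∈ E, 0 ≤ m i) (hu : ∀ i ∈ E, ‖u i‖ = 1)
    (hu1 : ∀ i ∈ E, u i ≠ 1) (N L : ℕ) :
    |∑ n ∈ Ico N (N + L), trigSum E m u n| ≤ meanConst E m u := by
  unfold trigSum meanConst
  rw [Finset.sum_comm]
  refine (Finset.abs_sum_le_sum_abs _ _).trans (Finset.sum_le_sum fun i hi ↦ ?_)
  rw [← Finset.mul_sum, ← Complex.re_sum, abs_mul, abs_of_nonneg (hm i hi)]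
  exact mul_le_mul_of_nonneg_left (abs_re_sum_Ico_pow_le (hu i hi).le (hu1 i hi) N L) (hm i hi)

/-- `Re a · Re b = (Re(ab) + Re(a b̄))/2`. -/
theorem re_mul_re (a b : ℂ) : a.re * b.re = ((a * b).re + (a * conj b).re) / 2 := by
  simp only [Complex.mul_re, Complex.conj_re, Complex.conj_im]
  ring

/-- The window mean square of `h` is at least `σ²/2` up to a bounded error:
`(L/2) σ² − C₂ ≤ Σ_{n ∈ [N,N+L)} h(n)²` (the diagonal `u_i ū_i = 1` contributes `m_i² L/2`; every other
resonance contributes non-negatively because the weights are positive). -/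
theorem sum_trigSum_sq_ge (hm : ∀ i ∈ E, 0 ≤ m i) (hu : ∀ i ∈ E, ‖u i‖ = 1) (N L : ℕ) :
    (L : ℝ) / 2 * sqMass E m - varConst E m u ≤ ∑ n ∈ Ico N (N + L), trigSum E m u n ^ 2 := by
  classical
  -- expand the square and swap the sums
  have hexp : ∀ n, trigSum E m u n ^ 2 =
      ∑ i ∈ E, ∑ j ∈ E, m i * m j * ((((u i * u j) ^ n).re + ((u i * conj (u j)) ^ n).re) / 2) := by
    intro n
    rw [trigSum, sq, Finset.sum_mul_sum]
    refine Finset.sum_congr rfl fun i _ ↦ Finset.sum_congr rfl fun j _ ↦ ?_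
    rw [mul_pow, mul_pow, ← map_pow, ← re_mul_re]
    ring
  simp_rw [hexp]
  rw [Finset.sum_comm]
  simp_rw [Finset.sum_comm (s := Ico N (N + L)) (t := E), ← Finset.mul_sum, ← Finset.sum_div,
    Finset.sum_add_distrib, ← Complex.re_sum]
  -- termwise lower bound
  have hterm : ∀ i ∈ E, ∀ j ∈ E,
      -(m i * m j * (1 / ‖1 - u i * u j‖ + 1 / ‖1 - u i * conj (u j)‖)) +
          (if i = j then m i ^ 2 * ((L : ℝ) / 2) else 0) ≤
        m i * m j * (((∑ n ∈ Ico N (N + L), (u i * u j) ^ n).re +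
          (∑ n ∈ Ico N (N + L), (u i * conj (u j)) ^ n).re) / 2) := by
    intro i hi j hj
    have hij1 : ‖u i * u j‖ ≤ 1 := by rw [norm_mul, hu i hi, hu j hj, one_mul]
    have hij2 : ‖u i * conj (u j)‖ ≤ 1 := by rw [norm_mul, Complex.norm_conj, hu i hi, hu j hj, one_mul]
    have hA := neg_le_re_sum_Ico_pow hij1 N L
    have hB := neg_le_re_sum_Ico_pow hij2 N L
    rw [div_eq_mul_one_div] at hA hB
    have hmm : 0 ≤ m i * m j := mul_nonneg (hm i hi) (hm j hj)
    by_cases hij : i = j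
    · subst hij
      have hone : u i * conj (u i) = 1 := by
        rw [Complex.mul_conj, ← Complex.sq_norm, hu i hi]; norm_num
      rw [if_pos rfl, hone]
      simp only [sub_self, norm_zero, div_zero, add_zero, one_pow, Finset.sum_const, Nat.card_Ico,
        nsmul_eq_mul, mul_one, Complex.natCast_re]
      have hL : ((N + L - N : ℕ) : ℝ) = L := by rw [Nat.add_sub_cancel_left]
      rw [hL]
      have h2 := mul_le_mul_of_nonneg_left hA hmm
      have e : m i ^ 2 = m i * m i := sq (m i)
      rw [e]
      linarith
    · rw [if_neg hij, add_zero]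
      have h2 := mul_le_mul_of_nonneg_left (add_le_add hA hB) hmm
      linarith
  calc (L : ℝ) / 2 * sqMass E m - varConst E m u
      = ∑ i ∈ E, ∑ j ∈ E, (-(m i * m j * (1 / ‖1 - u i * u j‖ + 1 / ‖1 - u i * conj (u j)‖)) +
          (if i = j then m i ^ 2 * ((L : ℝ) / 2) else 0)) := by
        simp only [Finset.sum_add_distrib, Finset.sum_neg_distrib, Finset.sum_ite_eq, sqMass, varConst]
        have : ∑ i ∈ E, (if i ∈ E then m i ^ 2 * ((L : ℝ) / 2) else 0) =
            (∑ i ∈ E, m i ^ 2) * ((L : ℝ) / 2) := by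
          rw [Finset.sum_mul]; exact Finset.sum_congr rfl fun i hi ↦ by rw [if_pos hi]
        rw [this]
        ring
    _ ≤ _ := Finset.sum_le_sum fun i hi ↦ Finset.sum_le_sum fun j hj ↦ hterm i hi j hj

/-- Pointwise: `|x| ≤ M`, `0 < η`, `x < η` ⟹ `x² ≤ M(2η − x)`. -/
theorem sq_le_of_lt {x M η : ℝ} (hM : |x| ≤ M) (hη : 0 < η) (hx : x < η) :
    x ^ 2 ≤ M * (2 * η - x) := by
  have hM0 : 0 ≤ M := (abs_nonneg x).trans hM
  have h1 : |x| ≤ 2 * η - x := by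
    rcases le_or_gt 0 x with h | h
    · rw [abs_of_nonneg h]; linarith
    · rw [abs_of_neg h]; linarith
  calc x ^ 2 = |x| * |x| := by rw [← sq, sq_abs]
    _ ≤ M * (2 * η - x) := mul_le_mul hM h1 (abs_nonneg _) hM0

/-- Pointwise: `|x| ≤ M`, `0 < η`, `−η < x` ⟹ `x² ≤ M(2η + x)`. -/
theorem sq_le_of_gt {x M η : ℝ} (hM : |x| ≤ M) (hη : 0 < η) (hx : -η < x) :
    x ^ 2 ≤ M * (2 * η + x) := by
  have := sq_le_of_lt (x := -x) (M := M) (η := η) (by rwa [abs_neg]) hη (by linarith)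
  rw [neg_sq] at this
  linarith

/-- The window length `L₀ = ⌈4(C₂ + M C₁)/σ²⌉₊ + 1`. -/
def windowLen (E : Finset ι) (m : ι → ℝ) (u : ι → ℂ) : ℕ :=
  ⌈4 * (varConst E m u + mass E m * meanConst E m u) / sqMass E m⌉₊ + 1

/-- The margin `η = σ²/(8M)`. -/
def margin (E : Finset ι) (m : ι → ℝ) : ℝ := sqMass E m / (8 * mass E m)

/-- `η = σ²/(8M) > 0` for a non-empty family with positive weights. -/
theorem margin_pos (hE : E.Nonempty) (hm : ∀ i ∈ E, 0 < m i) : 0 < margin E m :=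
  div_pos (Finset.sum_pos (fun i hi ↦ pow_pos (hm i hi) 2) hE) (by
    have := Finset.sum_pos hm hE; unfold mass; positivity)

/-- **Window theorem.** A positive-weight trigonometric sum `h(n) = Σ_{i∈E} m_i Re(u_iⁿ)` on the unit
circle with no `u_i = 1` takes a value `≥ η` AND a value `≤ −η` in every window `[N, N + L₀)`,
`η = σ²/(8M) > 0`, `L₀ = ⌈4(C₂ + M C₁)/σ²⌉ + 1` (uniform in `N`; no Diophantine hypothesis on the `u_i`). -/
theorem window_two_signs (hE : E.Nonempty) (hm : ∀ i ∈ E, 0 < m i) (hu : ∀ i ∈ E, ‖u i‖ = 1)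
    (hu1 : ∀ i ∈ E, u i ≠ 1) (N : ℕ) :
    (∃ n ∈ Ico N (N + windowLen E m u), margin E m ≤ trigSum E m u n) ∧
    (∃ n ∈ Ico N (N + windowLen E m u), trigSum E m u n ≤ -margin E m) := by
  have hM : 0 < mass E m := Finset.sum_pos hm hE
  have hσ : 0 < sqMass E m := Finset.sum_pos (fun i hi ↦ pow_pos (hm i hi) 2) hE
  have hη : 0 < margin E m := margin_pos hE hm
  have hm' : ∀ i ∈ E, 0 ≤ m i := fun i hi ↦ (hm i hi).le
  set L := windowLen E m u with hLdef
  have hLgt : 4 * (varConst E m u + mass E m * meanConst E m u) / sqMass E m < L := by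
    rw [hLdef, windowLen, Nat.cast_add, Nat.cast_one]
    exact (Nat.le_ceil _).trans_lt (lt_add_one _)
  have hL' : 4 * (varConst E m u + mass E m * meanConst E m u) < L * sqMass E m := by
    rwa [div_lt_iff₀ hσ] at hLgt
  have hsq := sum_trigSum_sq_ge hm' hu N L
  have hmean := abs_sum_trigSum_le hm' hu hu1 N L
  have habs : ∀ n, |trigSum E m u n| ≤ mass E m := fun n ↦ abs_trigSum_le hm' hu n
  have hcard : ((Ico N (N + L)).card : ℝ) = L := by simp
  have h3 : mass E m * (2 * margin E m) = sqMass E m / 4 := by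
    rw [margin]; field_simp; ring
  constructor
  · by_contra h
    push Not at h
    have hpt : ∀ n ∈ Ico N (N + L),
        trigSum E m u n ^ 2 ≤ sqMass E m / 4 - mass E m * trigSum E m u n := by
      intro n hn
      have := sq_le_of_lt (habs n) hη (h n hn)
      rwa [mul_sub, h3] at this
    have hsum := Finset.sum_le_sum hpt
    rw [Finset.sum_sub_distrib, Finset.sum_const, nsmul_eq_mul, hcard, ← Finset.mul_sum] at hsum
    have h5 := mul_le_mul_of_nonneg_left (abs_le.1 hmean).1 hM.le
    linarith
  · by_contra h
    push Not at h
    have hpt : ∀ n ∈ Ico N (N + L),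
        trigSum E m u n ^ 2 ≤ sqMass E m / 4 + mass E m * trigSum E m u n := by
      intro n hn
      have := sq_le_of_gt (habs n) hη (h n hn)
      rwa [mul_add, h3] at this
    have hsum := Finset.sum_le_sum hpt
    rw [Finset.sum_add_distrib, Finset.sum_const, nsmul_eq_mul, hcard, ← Finset.mul_sum] at hsum
    have h5 := mul_le_mul_of_nonneg_left (abs_le.1 hmean).2 hM.le
    linarith

end Window

end Summit.RiemannHypothesis.RiemannHypothesis.Theorems.Splittings.LiExtremalLayer

end
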